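import Mathlib
import Summits.NavierStokesRegularity.NavierStokesRegularity.Theorems.LevelSetModerationHighSpeedPressureWorkSlabBounds
import Summits.NavierStokesRegularity.NavierStokesRegularity.Theorems.LevelSetModerationHighSpeedPressureWorkCostCauchySchwarz

/-!
# Route LevelSetModeration — `HighSpeedPressureWork`: the area law closes by dyadic extinction

Support file for item stmt-NavierStokesRegularity-18149 (`HighSpeedPressureWork`); proves the
registered stub `stub_areaLawClosure` of line `iso-speed-area-closure`, for ONE solution `u` and
ABSTRACT constants. Notation: `V(c) = ∫₀ᵀ |{c < |u(τ)|}| dτ` (occupation above `c`),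
`𝒜(c) = ∫₀ᵀ ∫ 1_{c < |u|} ‖D|u|‖` (the area functional), both as `toReal` of lower integrals.
Hypotheses on `u` (classical on `ℝ³ × [0,T)`, Leray–Hopf from a rapidly decaying datum with
`∫|u₀|² ≤ E₀`, `|u₀| ≤ B₀`):

* (REC) `V(2c) ≤ C E₀^{1/3} c^{-5/3} 𝒜(c)` for every `c > 0`;
* (QUANT) for every datum bound `B₁ > 0`, `T' < T`, `G' ≥ A₀ B₁`: if `|u| ≤ G'` on `[0,T'] × ℝ³`
  and `|u| > 3G'/4` somewhere there, then `κ ν⁴ / G'⁵ ≤ V(G'/2)`;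
* (LAW) `ν 𝒜(c) ≤ Λ₁ M^{m₁} V(c)` for `M ≥ 2B₀`, `c ∈ [M/2, M]`, `c > 0`, with `m₁ < 5/3`.

Conclusion: `‖u(t,x)‖ ≤ G` on `[0,T) × ℝ³` with `G` depending only on
`(ν, T, m₁, Λ₁, E₀, B₀, C, κ, A₀)`. Mechanism (dyadic extinction): with `γ = 5/3 − m₁ > 0` and
`Θ = C E₀⁺^{1/3} Λ₁⁺ 2^{m₁}/ν`, (REC) and (LAW) at `M = 2c` give `V(2c) ≤ Θ c^{−γ} V(c)` for
`c ≥ B₀`; from the level `c₁ = max(B₀, 1, (2Θ+1)^{1/γ})` on, `V(2^k c₁) ≤ V(c₁) 2^{-k} 2^{−γk(k−1)/2}`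
with `V(c₁) ≤ T E₀/c₁²` (Chebyshev); at the running maximum `S` of `|u|` over `[0,T'] × ℝ³` (finite
by the slab bound, approached at a point) the quantum gives `κν⁴/S⁵ ≤ V(S/2) ≤ V(2^k c₁)` where
`2^{k+1} c₁ ≤ S < 2^{k+2} c₁`, and the super-geometric decay beats `S⁵ ∼ 2^{5k}` beyond an explicit
index `K`, so `S ≤ max(A₀ B₁, 4 c₁ 2^K)`.
-/

noncomputable section

-- single-conjunct summit: `Summit.<Summit>.<Problem>` repeats the name by the D-0017 layout
set_option linter.dupNamespace false

namespace Summit.NavierStokesRegularity.NavierStokesRegularity.Theorems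

open MeasureTheory Set Filter Topology
open scoped ENNReal
open Literature.Analysis.FluidPDE

/-! ### Real-variable lemma: the super-geometric dyadic product -/

/-- **Super-geometric decay beats any geometric growth**: for `γ > 0` and any real `Ξ` there is `K`
such that `Ξ · 2^{4k} ≤ 2^{γ k (k−1)/2}` for all natural `k > K`. [folklore] -/
theorem areaLawClosure_exists_superGeometric_dominates {γ : ℝ} (hγ : 0 < γ) (Ξ : ℝ) :
    ∃ K : ℕ, ∀ k : ℕ, K < k →
      Ξ * (2 : ℝ) ^ (4 * (k : ℝ)) ≤ (2 : ℝ) ^ (γ * ((k : ℝ) * ((k : ℝ) - 1) / 2)) := by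
  -- `K₁`: beyond it the exponent exceeds `5k`; `K₂`: `2^{K₂} ≥ Ξ`
  obtain ⟨K₁, hK₁⟩ := exists_nat_gt (1 + 10 / γ)
  obtain ⟨K₂, hK₂⟩ := exists_nat_gt Ξ
  refine ⟨max K₁ K₂, fun k hk => ?_⟩
  have hk₁ : (K₁ : ℝ) < k := by exact_mod_cast (le_max_left K₁ K₂).trans_lt hk
  have hk₂ : (K₂ : ℝ) < k := by exact_mod_cast (le_max_right K₁ K₂).trans_lt hk
  -- exponent comparison: `γ k (k-1)/2 ≥ 5k` since `γ (k-1)/2 ≥ 5`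
  have hexp : 5 * (k : ℝ) ≤ γ * ((k : ℝ) * ((k : ℝ) - 1) / 2) := by
    have h1 : 1 + 10 / γ < k := hK₁.trans hk₁
    have h2 : 10 / γ < (k : ℝ) - 1 := by linarith
    have h3 : 10 < γ * ((k : ℝ) - 1) := by
      have := mul_lt_mul_of_pos_left h2 hγ
      rwa [mul_div_cancel₀ _ hγ.ne'] at this
    nlinarith
  have hΞ2 : Ξ ≤ (2 : ℝ) ^ (k : ℝ) := by
    have h1 : Ξ < (K₂ : ℝ) := hK₂
    have h2 : (K₂ : ℝ) < (2 : ℝ) ^ (K₂ : ℝ) := by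
      rw [Real.rpow_natCast]; exact_mod_cast K₂.lt_two_pow_self
    have h3 : (2 : ℝ) ^ (K₂ : ℝ) ≤ (2 : ℝ) ^ (k : ℝ) :=
      Real.rpow_le_rpow_of_exponent_le one_le_two hk₂.le
    linarith
  calc Ξ * (2 : ℝ) ^ (4 * (k : ℝ)) ≤ (2 : ℝ) ^ (k : ℝ) * (2 : ℝ) ^ (4 * (k : ℝ)) := by gcongr
    _ = (2 : ℝ) ^ (5 * (k : ℝ)) := by rw [← Real.rpow_add two_pos]; ring_nf
    _ ≤ (2 : ℝ) ^ (γ * ((k : ℝ) * ((k : ℝ) - 1) / 2)) :=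
        Real.rpow_le_rpow_of_exponent_le one_le_two hexp

/-! ### The closure (registered stub of line `iso-speed-area-closure`) -/

/-- **AREA LAW CLOSURE by dyadic extinction (registered stub `stub_areaLawClosure`).** For
`ν, T > 0`, `m₁ < 5/3`, a real `Λ₁`, data bounds `(E₀, B₀)` and constants `C, κ, A₀ > 0` there is
`G` (depending on these nine numbers only) such that every classical solution on `ℝ³ × [0,T)` that
is Leray–Hopf from a rapidly decaying datum with `∫|u₀|² ≤ E₀`, `|u₀| ≤ B₀` and obeys (REC) the
linear level recursion with constant `C`, (QUANT) the occupation quantum with `(κ, A₀)` at every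
datum bound, and (LAW) the iso-speed area law with `(Λ₁, m₁)` on all windows `M ≥ 2B₀`, satisfies
`‖u(t,x)‖ ≤ G` on `[0,T) × ℝ³`. [folklore] -/
theorem stub_areaLawClosure :
    ∀ (ν T m₁ Λ₁ E₀ B₀ C κ A₀ : ℝ), 0 < ν → 0 < T → m₁ < 5 / 3 → 0 < C → 0 < κ → 0 < A₀ → ∃ G : ℝ,
      ∀ (u : ℝ → EuclideanSpace ℝ (Fin 3) → EuclideanSpace ℝ (Fin 3))
        (p : ℝ → EuclideanSpace ℝ (Fin 3) → ℝ),
        Literature.Analysis.FluidPDE.IsClassicalNSSolutionOn (Set.Ico 0 T) ν 0 u p →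
        Literature.Analysis.FluidPDE.IsLerayHopfOn T ν 0 (u 0) u →
        Literature.Analysis.FluidPDE.HasRapidSpatialDecay (u 0) →
        (∫ x, ‖u 0 x‖ ^ 2) ≤ E₀ → (∀ x, ‖u 0 x‖ ≤ B₀) →
        (∀ c : ℝ, 0 < c →
          (∫⁻ τ in Set.Ioo 0 T, ∫⁻ x, Set.indicator {x | c < ‖u τ x‖}
              (fun x => ENNReal.ofReal ‖fderiv ℝ (fun y => ‖u τ y‖) x‖) x) ≠ ⊤ ∧
            (∫⁻ τ in Set.Ioo 0 T, volume {x | 2 * c < ‖u τ x‖}).toReal ≤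
              C * E₀ ^ (1 / 3 : ℝ) * c ^ (-(5 / 3 : ℝ)) *
                (∫⁻ τ in Set.Ioo 0 T, ∫⁻ x, Set.indicator {x | c < ‖u τ x‖}
                  (fun x => ENNReal.ofReal ‖fderiv ℝ (fun y => ‖u τ y‖) x‖) x).toReal) →
        (∀ B₁ : ℝ, 0 < B₁ → (∀ x, ‖u 0 x‖ ≤ B₁) → ∀ (T' G' : ℝ), T' < T → A₀ * B₁ ≤ G' →
          (∀ t ∈ Set.Icc 0 T', ∀ x, ‖u t x‖ ≤ G') → (∃ t ∈ Set.Icc 0 T', ∃ x, 3 / 4 * G' < ‖u t x‖) →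
          κ * ν ^ 4 / G' ^ 5 ≤ (∫⁻ τ in Set.Ioo 0 T, volume {x | G' / 2 < ‖u τ x‖}).toReal) →
        (∀ (M c : ℝ), 2 * B₀ ≤ M → M / 2 ≤ c → c ≤ M → 0 < c →
          ν * (∫⁻ τ in Set.Ioo 0 T, ∫⁻ x, Set.indicator {x | c < ‖u τ x‖}
              (fun x => ENNReal.ofReal ‖fderiv ℝ (fun y => ‖u τ y‖) x‖) x).toReal ≤
            Λ₁ * M ^ m₁ * (∫⁻ τ in Set.Ioo 0 T, volume {x | c < ‖u τ x‖}).toReal) →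
        ∀ t ∈ Set.Ico 0 T, ∀ x, ‖u t x‖ ≤ G := by
  intro ν T m₁ Λ₁ E₀ B₀ C κ A₀ hν hT hm₁ hC hκ hA₀
  -- the class constants (chosen BEFORE `u`)
  set γ : ℝ := 5 / 3 - m₁ with hγdef
  have hγ : 0 < γ := by rw [hγdef]; linarith
  set Θ : ℝ := C * (max E₀ 0) ^ (1 / 3 : ℝ) * max Λ₁ 0 * (2 : ℝ) ^ m₁ / ν with hΘ
  have hΘ0 : 0 ≤ Θ := by positivity
  set B₁ : ℝ := max B₀ 1 with hB₁
  have hB₁pos : 0 < B₁ := lt_of_lt_of_le one_pos (le_max_right B₀ 1)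
  have hB₀B₁ : B₀ ≤ B₁ := le_max_left B₀ 1
  set c₁ : ℝ := max B₁ ((2 * Θ + 1) ^ (1 / γ)) with hc₁
  have hc₁1 : 1 ≤ c₁ := (le_max_right B₀ 1).trans (le_max_left _ _)
  have hc₁B : B₀ ≤ c₁ := hB₀B₁.trans (le_max_left _ _)
  have hc₁pos : 0 < c₁ := lt_of_lt_of_le one_pos hc₁1
  have hc₁Θ : Θ * c₁ ^ (-γ) ≤ 1 / 2 := by
    have h1 : (2 * Θ + 1) ^ (1 / γ) ≤ c₁ := le_max_right _ _
    have h2 : 2 * Θ + 1 ≤ c₁ ^ γ := by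
      have := Real.rpow_le_rpow (by positivity) h1 hγ.le
      rwa [← Real.rpow_mul (by linarith), one_div_mul_cancel hγ.ne', Real.rpow_one] at this
    rw [Real.rpow_neg hc₁pos.le, ← div_eq_mul_inv, div_le_iff₀ (Real.rpow_pos_of_pos hc₁pos γ)]
    nlinarith
  set Ξ : ℝ := T * max E₀ 0 * c₁ ^ 3 * (2 : ℝ) ^ (10 : ℝ) / (κ * ν ^ 4) with hΞ
  -- the index `K` beyond which the super-geometric product wins
  obtain ⟨K, hKspec⟩ := areaLawClosure_exists_superGeometric_dominates hγ Ξ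
  refine ⟨max (A₀ * B₁) (4 * c₁ * (2 : ℝ) ^ K), ?_⟩
  intro u p hcl hLH hdec hE₀ hB₀bd hrec hQ hlaw t ht x
  have hE₀0 : 0 ≤ E₀ := le_trans (integral_nonneg fun _ => sq_nonneg _) hE₀
  have hmaxE : max E₀ 0 = E₀ := max_eq_left hE₀0
  -- the running maximum on `[0, T']`, `T' = (t + T)/2`
  set T' : ℝ := (t + T) / 2 with hT'
  have hT'pos : 0 < T' := by rw [hT']; linarith [ht.1]
  have hT'T : T' < T := by rw [hT']; linarith [ht.2]
  have htT' : t ≤ T' := by rw [hT']; linarith [ht.2]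
  obtain ⟨Mb, -, hMb⟩ := levelSetModeration_slab_velocity_bound hν hcl hLH hdec ⟨hT'pos, hT'T⟩
  set S : Set ℝ := (fun q : ℝ × EuclideanSpace ℝ (Fin 3) => ‖u q.1 q.2‖) '' (Icc 0 T' ×ˢ univ)
    with hS
  have hSbdd : BddAbove S := by
    refine ⟨Mb, ?_⟩
    rintro a ⟨⟨s, y⟩, ⟨hs, -⟩, rfl⟩
    exact hMb s hs y
  have hSne : S.Nonempty := ⟨‖u 0 0‖, ⟨(0, 0), ⟨⟨le_rfl, hT'pos.le⟩, mem_univ _⟩, rfl⟩⟩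
  set G : ℝ := sSup S with hG
  have hGbd : ∀ s ∈ Icc 0 T', ∀ y, ‖u s y‖ ≤ G := fun s hs y =>
    le_csSup hSbdd ⟨(s, y), ⟨hs, mem_univ y⟩, rfl⟩
  -- it suffices to bound `G`
  suffices hGle : G ≤ max (A₀ * B₁) (4 * c₁ * (2 : ℝ) ^ K) from
    (hGbd t ⟨ht.1, htT'⟩ x).trans hGle
  by_contra hGgt
  rw [not_le] at hGgt
  have hGA : A₀ * B₁ < G := lt_of_le_of_lt (le_max_left _ _) hGgt
  have hGc : 4 * c₁ * (2 : ℝ) ^ K < G := lt_of_le_of_lt (le_max_right _ _) hGgt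
  have hGpos : 0 < G := lt_trans (by positivity) hGA
  -- a near-maximum point
  obtain ⟨a, ⟨⟨s₂, y₂⟩, ⟨hs₂, -⟩, rfl⟩, ha⟩ :=
    exists_lt_of_lt_csSup hSne (show 3 / 4 * G < sSup S by rw [← hG]; linarith)
  -- the occupation quantum at level `G/2` (datum bound `B₁ ≥ B₀`, `B₁ > 0`)
  have hquant : κ * ν ^ 4 / G ^ 5 ≤
      (∫⁻ τ in Ioo 0 T, volume {x | G / 2 < ‖u τ x‖}).toReal :=
    hQ B₁ hB₁pos (fun y => (hB₀bd y).trans hB₀B₁) T' G hT'T hGA.le hGbd ⟨s₂, hs₂, y₂, ha⟩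
  -- the dyadic levels `2^k c₁`
  set V : ℕ → ℝ := fun k =>
    (∫⁻ τ in Ioo 0 T, volume {x | (2 : ℝ) ^ k * c₁ < ‖u τ x‖}).toReal with hV
  have hVfin : ∀ c : ℝ, 0 < c → (∫⁻ τ in Ioo 0 T, volume {x | c < ‖u τ x‖}) ≠ ⊤ := fun c hc =>
    levelSetModeration_highSetMeasure_ne_top hν.le hLH hc
  -- one recursion step: `V (k+1) ≤ (1/2) 2^{-γ k} V k`
  have hstep : ∀ k : ℕ, V (k + 1) ≤ (1 / 2) * (2 : ℝ) ^ (-(γ * k)) * V k := by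
    intro k
    set c : ℝ := (2 : ℝ) ^ k * c₁ with hc
    have hcpos : 0 < c := by rw [hc]; positivity
    have hcB : B₀ ≤ c := by
      rw [hc]
      calc B₀ ≤ c₁ := hc₁B
        _ = 1 * c₁ := (one_mul _).symm
        _ ≤ (2 : ℝ) ^ k * c₁ := by gcongr; exact one_le_pow₀ one_le_two
    -- the recursion and the law at `M = 2c`, level `c`
    obtain ⟨-, hR⟩ := hrec c hcpos
    have hL := hlaw (2 * c) c (by linarith) (by linarith) (by linarith) hcpos
    set A : ℝ := (∫⁻ τ in Ioo 0 T, ∫⁻ x, {x | c < ‖u τ x‖}.indicator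
      (fun x => ENNReal.ofReal ‖fderiv ℝ (fun y => ‖u τ y‖) x‖) x).toReal with hA
    have hA0 : 0 ≤ A := ENNReal.toReal_nonneg
    have hVk : V k = (∫⁻ τ in Ioo 0 T, volume {x | c < ‖u τ x‖}).toReal := rfl
    have hVk1 : V (k + 1) = (∫⁻ τ in Ioo 0 T, volume {x | 2 * c < ‖u τ x‖}).toReal := by
      simp only [hV, hc, pow_succ]; ring_nf
    have hVk0 : 0 ≤ V k := ENNReal.toReal_nonneg
    -- `Λ₁ ≤ Λ₁⁺`
    have hL' : ν * A ≤ max Λ₁ 0 * (2 * c) ^ m₁ * V k := by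
      have hfac : 0 ≤ (2 * c) ^ m₁ * V k := mul_nonneg (Real.rpow_nonneg (by linarith) m₁) hVk0
      calc ν * A ≤ Λ₁ * (2 * c) ^ m₁ * V k := by rw [hVk]; exact hL
        _ = Λ₁ * ((2 * c) ^ m₁ * V k) := by ring
        _ ≤ max Λ₁ 0 * ((2 * c) ^ m₁ * V k) :=
            mul_le_mul_of_nonneg_right (le_max_left _ _) hfac
        _ = max Λ₁ 0 * (2 * c) ^ m₁ * V k := by ring
    -- combine
    have hcomb : V (k + 1) ≤ C * E₀ ^ (1 / 3 : ℝ) * c ^ (-(5 / 3 : ℝ)) *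
        (max Λ₁ 0 * (2 * c) ^ m₁ * V k / ν) := by
      rw [hVk1]
      refine hR.trans ?_
      have hK0 : 0 ≤ C * E₀ ^ (1 / 3 : ℝ) * c ^ (-(5 / 3 : ℝ)) := by positivity
      refine mul_le_mul_of_nonneg_left ?_ hK0
      rw [le_div_iff₀ hν]
      linarith
    -- the algebra: the right-hand side is `Θ c^{-γ} V k`
    have h2c : (2 * c) ^ m₁ = (2 : ℝ) ^ m₁ * c ^ m₁ := Real.mul_rpow zero_le_two hcpos.le
    have hcexp : c ^ (-(5 / 3 : ℝ)) * c ^ m₁ = c ^ (-γ) := by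
      rw [← Real.rpow_add hcpos, hγdef]; ring_nf
    have hΘE : Θ = C * E₀ ^ (1 / 3 : ℝ) * max Λ₁ 0 * (2 : ℝ) ^ m₁ / ν := by rw [hΘ, hmaxE]
    have hΘeq : C * E₀ ^ (1 / 3 : ℝ) * c ^ (-(5 / 3 : ℝ)) *
        (max Λ₁ 0 * (2 * c) ^ m₁ * V k / ν) = Θ * c ^ (-γ) * V k := by
      rw [hΘE, h2c, ← hcexp]
      rw [div_mul_eq_mul_div, div_mul_eq_mul_div, mul_div_assoc, mul_div_assoc]
      ring
    have hcγ : Θ * c ^ (-γ) ≤ (1 / 2) * (2 : ℝ) ^ (-(γ * k)) := by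
      rw [hc, Real.mul_rpow (by positivity) hc₁pos.le, ← Real.rpow_natCast (2 : ℝ) k,
        ← Real.rpow_mul zero_le_two]
      have h2 : 0 ≤ (2 : ℝ) ^ ((k : ℝ) * -γ) := Real.rpow_nonneg zero_le_two _
      calc Θ * ((2 : ℝ) ^ ((k : ℝ) * -γ) * c₁ ^ (-γ))
          = (2 : ℝ) ^ ((k : ℝ) * -γ) * (Θ * c₁ ^ (-γ)) := by ring
        _ ≤ (2 : ℝ) ^ ((k : ℝ) * -γ) * (1 / 2) := mul_le_mul_of_nonneg_left hc₁Θ h2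
        _ = (1 / 2) * (2 : ℝ) ^ (-(γ * k)) := by ring_nf
    calc V (k + 1) ≤ Θ * c ^ (-γ) * V k := by rw [← hΘeq]; exact hcomb
      _ ≤ (1 / 2) * (2 : ℝ) ^ (-(γ * k)) * V k := mul_le_mul_of_nonneg_right hcγ hVk0
  -- the super-geometric bound by induction
  have hind : ∀ k : ℕ,
      V k ≤ V 0 * (1 / 2) ^ k * (2 : ℝ) ^ (-(γ * ((k : ℝ) * ((k : ℝ) - 1) / 2))) := by
    intro k
    induction k with
    | zero => simp
    | succ k ih =>
      have hVk0 : 0 ≤ V 0 := ENNReal.toReal_nonneg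
      have hfac : 0 ≤ (1 / 2) * (2 : ℝ) ^ (-(γ * k)) := by positivity
      calc V (k + 1) ≤ (1 / 2) * (2 : ℝ) ^ (-(γ * k)) * V k := hstep k
        _ ≤ (1 / 2) * (2 : ℝ) ^ (-(γ * k)) *
            (V 0 * (1 / 2) ^ k * (2 : ℝ) ^ (-(γ * ((k : ℝ) * ((k : ℝ) - 1) / 2)))) :=
          mul_le_mul_of_nonneg_left ih hfac
        _ = V 0 * (1 / 2) ^ (k + 1) *
            (2 : ℝ) ^ (-(γ * (((k + 1 : ℕ) : ℝ) * (((k + 1 : ℕ) : ℝ) - 1) / 2))) := by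
          rw [pow_succ, Nat.cast_succ]
          rw [show -(γ * (((k : ℝ) + 1) * ((k : ℝ) + 1 - 1) / 2)) =
              -(γ * k) + -(γ * ((k : ℝ) * ((k : ℝ) - 1) / 2)) by ring, Real.rpow_add two_pos]
          ring
  -- `V 0 ≤ T E₀ / c₁²` (slice Chebyshev and the energy inequality)
  have hV0 : V 0 ≤ T * E₀ / c₁ ^ 2 := by
    have hV0eq : V 0 = (∫⁻ τ in Ioo 0 T, volume {x | c₁ < ‖u τ x‖}).toReal := by
      simp only [hV, pow_zero, one_mul]
    rw [hV0eq]
    have hkin : 2 * VectorCalculus.kineticEnergy (u 0) ≤ E₀ := by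
      rw [VectorCalculus.kineticEnergy]; linarith
    have h1 : (∫⁻ τ in Ioo 0 T, volume {x | c₁ < ‖u τ x‖}) ≤
        ∫⁻ _ in Ioo 0 T, ENNReal.ofReal (E₀ / c₁ ^ 2) := by
      refine lintegral_mono_ae ?_
      filter_upwards [ae_restrict_mem measurableSet_Ioo] with τ hτ
      refine (levelSetModeration_volume_superlevel_le hν.le hLH ⟨hτ.1.le, hτ.2.le⟩ hc₁pos).trans ?_
      rw [← ENNReal.ofReal_div_of_pos (by positivity)]
      exact ENNReal.ofReal_le_ofReal (div_le_div_of_nonneg_right hkin (sq_nonneg _))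
    rw [setLIntegral_const, Real.volume_Ioo, sub_zero] at h1
    refine (ENNReal.toReal_mono (ENNReal.mul_ne_top ENNReal.ofReal_ne_top ENNReal.ofReal_ne_top)
      h1).trans ?_
    rw [ENNReal.toReal_mul, ENNReal.toReal_ofReal (div_nonneg hE₀0 (sq_nonneg _)),
      ENNReal.toReal_ofReal hT.le]
    exact le_of_eq (by ring)
  -- the dyadic index of `G/2`
  have hG2c : 1 ≤ G / (2 * c₁) := by
    rw [le_div_iff₀ (by positivity)]
    have : (1 : ℝ) ≤ (2 : ℝ) ^ K := one_le_pow₀ one_le_two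
    nlinarith
  obtain ⟨k, hk1, hk2⟩ := exists_nat_pow_near hG2c one_lt_two
  -- `k > K`
  have hkK : K < k := by
    have h1 : (2 : ℝ) ^ (K + 1) < G / (2 * c₁) := by
      rw [lt_div_iff₀ (by positivity), pow_succ]; linarith
    have h2 : (2 : ℝ) ^ (K + 1) < (2 : ℝ) ^ (k + 1) := h1.trans hk2
    have := (pow_lt_pow_iff_right₀ (one_lt_two : (1 : ℝ) < 2)).1 h2
    omega
  -- `V_{G/2} ≤ V k` (level `2^k c₁ ≤ G/2`)
  have hlev : (2 : ℝ) ^ k * c₁ ≤ G / 2 := by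
    rw [le_div_iff₀ (by positivity)] at hk1
    linarith
  have hmono : (∫⁻ τ in Ioo 0 T, volume {x | G / 2 < ‖u τ x‖}).toReal ≤ V k := by
    refine ENNReal.toReal_mono (hVfin _ (by positivity)) (lintegral_mono fun τ => ?_)
    exact measure_mono fun y hy => lt_of_le_of_lt hlev hy
  -- `G < 2^{k+2} c₁`
  have hGlt : G < (2 : ℝ) ^ (k + 2) * c₁ := by
    rw [div_lt_iff₀ (by positivity)] at hk2
    calc G < (2 : ℝ) ^ (k + 1) * (2 * c₁) := hk2
      _ = (2 : ℝ) ^ (k + 2) * c₁ := by ring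
  -- the exponent and the powers of two
  set e : ℝ := γ * ((k : ℝ) * ((k : ℝ) - 1) / 2) with he
  have hhalf : (1 / 2 : ℝ) ^ k = (2 : ℝ) ^ (-(k : ℝ)) := by
    rw [Real.rpow_neg zero_le_two, Real.rpow_natCast, one_div, inv_pow]
  have hpow2 : ((2 : ℝ) ^ (k + 2) * c₁) ^ 5 =
      (2 : ℝ) ^ (10 : ℝ) * (2 : ℝ) ^ (5 * (k : ℝ)) * c₁ ^ 5 := by
    have h1 : ((2 : ℝ) ^ (k + 2)) ^ 5 = (2 : ℝ) ^ (10 : ℝ) * (2 : ℝ) ^ (5 * (k : ℝ)) := by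
      rw [← Real.rpow_add two_pos, ← pow_mul, ← Real.rpow_natCast]
      congr 1; push_cast; ring
    rw [mul_pow, h1]
  have hnk : (2 : ℝ) ^ (-(k : ℝ)) * (2 : ℝ) ^ (5 * (k : ℝ)) = (2 : ℝ) ^ (4 * (k : ℝ)) := by
    rw [← Real.rpow_add two_pos]; ring_nf
  have hneg : (2 : ℝ) ^ (-e) * (2 : ℝ) ^ e = 1 := by
    rw [← Real.rpow_add two_pos, neg_add_cancel, Real.rpow_zero]
  have hE : 0 < (2 : ℝ) ^ e := Real.rpow_pos_of_pos two_pos e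
  -- `κ ν⁴ ≤ V k · G⁵ ≤ (T E₀/c₁²) 2^{-k} 2^{-e} G⁵`
  have hQ' : κ * ν ^ 4 ≤ V k * G ^ 5 := by
    have := hquant.trans hmono
    rwa [div_le_iff₀ (by positivity)] at this
  have hVk_le : V k ≤ T * E₀ / c₁ ^ 2 * (2 : ℝ) ^ (-(k : ℝ)) * (2 : ℝ) ^ (-e) := by
    have h1 := hind k
    rw [hhalf] at h1
    refine h1.trans ?_
    gcongr
  -- the case `E₀ = 0` is immediate (`V k = 0` would force `κ ν⁴ ≤ 0`)
  rcases eq_or_lt_of_le hE₀0 with hE0 | hEpos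
  · have : V k ≤ 0 := by rw [← hE0] at hVk_le; simpa using hVk_le
    have hVk0 : 0 ≤ V k := ENNReal.toReal_nonneg
    have : V k * G ^ 5 = 0 := by rw [le_antisymm this hVk0, zero_mul]
    have : κ * ν ^ 4 ≤ 0 := by rw [this] at hQ'; exact hQ'
    have : 0 < κ * ν ^ 4 := by positivity
    linarith
  have hG5 : G ^ 5 < (2 : ℝ) ^ (10 : ℝ) * (2 : ℝ) ^ (5 * (k : ℝ)) * c₁ ^ 5 := by
    calc G ^ 5 < ((2 : ℝ) ^ (k + 2) * c₁) ^ 5 := pow_lt_pow_left₀ hGlt hGpos.le (by norm_num)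
      _ = _ := hpow2
  have hfacpos : 0 < T * E₀ / c₁ ^ 2 * (2 : ℝ) ^ (-(k : ℝ)) * (2 : ℝ) ^ (-e) := by positivity
  have hstrict : κ * ν ^ 4 < T * E₀ / c₁ ^ 2 * (2 : ℝ) ^ (-(k : ℝ)) * (2 : ℝ) ^ (-e) *
      ((2 : ℝ) ^ (10 : ℝ) * (2 : ℝ) ^ (5 * (k : ℝ)) * c₁ ^ 5) := by
    calc κ * ν ^ 4 ≤ V k * G ^ 5 := hQ'
      _ ≤ T * E₀ / c₁ ^ 2 * (2 : ℝ) ^ (-(k : ℝ)) * (2 : ℝ) ^ (-e) * G ^ 5 :=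
          mul_le_mul_of_nonneg_right hVk_le (by positivity)
      _ < _ := mul_lt_mul_of_pos_left hG5 hfacpos
  have hrhs : T * E₀ / c₁ ^ 2 * (2 : ℝ) ^ (-(k : ℝ)) * (2 : ℝ) ^ (-e) *
      ((2 : ℝ) ^ (10 : ℝ) * (2 : ℝ) ^ (5 * (k : ℝ)) * c₁ ^ 5) =
      T * E₀ * c₁ ^ 3 * (2 : ℝ) ^ (10 : ℝ) * (2 : ℝ) ^ (4 * (k : ℝ)) * (2 : ℝ) ^ (-e) := by
    rw [← hnk]
    field_simp
  rw [hrhs] at hstrict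
  -- multiply by `2^e`: `κ ν⁴ 2^e < T E₀ c₁³ 2^{10} 2^{4k}`
  have hstrict' : κ * ν ^ 4 * (2 : ℝ) ^ e <
      T * E₀ * c₁ ^ 3 * (2 : ℝ) ^ (10 : ℝ) * (2 : ℝ) ^ (4 * (k : ℝ)) := by
    have := mul_lt_mul_of_pos_right hstrict hE
    calc κ * ν ^ 4 * (2 : ℝ) ^ e < T * E₀ * c₁ ^ 3 * (2 : ℝ) ^ (10 : ℝ) *
          (2 : ℝ) ^ (4 * (k : ℝ)) * (2 : ℝ) ^ (-e) * (2 : ℝ) ^ e := this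
      _ = T * E₀ * c₁ ^ 3 * (2 : ℝ) ^ (10 : ℝ) * (2 : ℝ) ^ (4 * (k : ℝ)) *
          ((2 : ℝ) ^ (-e) * (2 : ℝ) ^ e) := by ring
      _ = _ := by rw [hneg, mul_one]
  -- the choice of `K`: `Ξ 2^{4k} ≤ 2^e`, i.e. `T E₀ c₁³ 2^{10} 2^{4k} ≤ κ ν⁴ 2^e`
  have hdom := hKspec k hkK
  have hdom' : T * E₀ * c₁ ^ 3 * (2 : ℝ) ^ (10 : ℝ) * (2 : ℝ) ^ (4 * (k : ℝ)) ≤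
      κ * ν ^ 4 * (2 : ℝ) ^ e := by
    have h1 : Ξ = T * E₀ * c₁ ^ 3 * (2 : ℝ) ^ (10 : ℝ) / (κ * ν ^ 4) := by rw [hΞ, hmaxE]
    rw [h1, div_mul_eq_mul_div, div_le_iff₀ (by positivity)] at hdom
    linarith
  linarith

end Summit.NavierStokesRegularity.NavierStokesRegularity.Theorems

end
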